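import Summits.BirchSwinnertonDyer.BirchSwinnertonDyer.Theorems.RamifiedSevenEllipticUnitsKummerChartIndex
import HarnessLib

/-!
# K7r value line, stub S_dict′ (`RamifiedCMLocalMordellWeilDictAtZp`, E-Zp successor of crux 19705):
# the local Kummer compact group is TORSION-FREE and the chart DETECTS `ℤ_p`-relations among Kummer
# families; `ℤ_p`-arithmetic of `padicPi` on Kummer families (cell `bsd-cm`, seat `bsd-cm-k7r-c3` g6;
# helper file, `--supports` 19705)

HONEST FRAMING. Nothing is asserted about the crux; BSD is not proved by any of this. Companion of
`RamifiedSevenEllipticUnitsKummerChartIndex.lean` (same hypotheses: `W` elliptic over a perfect field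
`K`, `E` a perfect `K`-field, `ι : K̄ → K̄_E`, a chart `Φ : E_E(E) → V` with torsion kernel onto a
torsion-free `p`-adically separated `ℤ_p`-module, `E_E(E)[p] = 0`), exposing two by-products of the
core theorem needed by the INJECTIVITY conjunct (inj) of the E-Zp dictionary S_dict′
(`loc_𝔭 x` torsion ⇒ `x` torsion on the global Mordell–Weil Kummer span):

* `localKummer_torsionFree_and_chart_detects`: (1) `E(L·E) ⊗ ℤ_p` (the tree's
  `localKummerCompactOfEmb ι p ⊤`) meets the torsion of `∏_k H¹(H_E, E[p^k])` trivially; (2) a relation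
  `c₁ · κ(R₁) + c₂ · κ(R₂) = 0` between the Kummer families of two `E`-rational points forces
  `c₁ Φ(R₁) + c₂ Φ(R₂) = 0` in the chart (the factorisation `ψ` of the core is injective and `ℤ_p`-linear).
* §1: the `ℤ_p`-action `padicPi c` is ADDITIVE and `ℤ`-compatible IN `c` on families killed level-wise by
  `p^k` (`padicPi_add_left_of_levelTorsion`, `padicPi_neg_left_of_levelTorsion`,
  `padicPi_intCast_mul_left_of_levelTorsion`, `padicPi_zero_left`), and Kummer families are such
  (`levelTorsion_kummerFamily`): the `ℤ/p^k`-module structure of `H¹(H, E[p^k])` read through `ℤ`.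

References: B. Perrin-Riou, Bull. SMF 115 (1987) §0 p. 401 (`S_p(L)` is a `ℤ_p`-module); J. H. Silverman,
*AEC* (2009) VIII.§2; cell line card `Lines/rubin-formula-zp.md` (k7r-c4 g5), stub S_dict′.
-/

set_option linter.dupNamespace false

noncomputable section

open scoped Classical

open WeierstrassCurve Literature.NumberTheory.EllipticCurves

universe u

namespace Summit.BirchSwinnertonDyer.BirchSwinnertonDyer.Theorems.RamifiedSevenEllipticUnits.KummerCore

/-! ## §1 `ℤ_p`-arithmetic of `padicPi` on level-wise `p^k`-torsion families -/

section PadicPi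

variable {F : Type u} [Field F] (V : WeierstrassCurve F) (p : ℕ) [Fact p.Prime]
  (H' : Subgroup (Field.absoluteGaloisGroup F))

omit [Fact p.Prime] in
/-- Two integers with the same image in `ℤ/p^k` act equally on an element killed by `p^k`. [folklore] -/
theorem zsmul_eq_zsmul_of_intCast_eq {A : Type*} [AddCommGroup A] {k : ℕ} {y : A}
    (hy : ((p : ℤ) ^ k) • y = 0) {a b : ℤ} (h : (a : ZMod (p ^ k)) = (b : ZMod (p ^ k))) :
    a • y = b • y := by
  obtain ⟨q, hq⟩ := (ZMod.intCast_eq_intCast_iff_dvd_sub a b (p ^ k)).1 h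
  have hb : b = a + (p ^ k : ℕ) * q := by linear_combination hq
  rw [hb, add_smul, mul_comm, ← smul_smul, Nat.cast_pow, hy, smul_zero, add_zero]

/-- `padicPi 0 = 0`. [cite: PerrinRiou1987BSMF, §0 p. 401] -/
theorem padicPi_zero_left (y : V.torsionH1Pi p H') : V.padicPi p H' 0 y = 0 := by
  ext k
  rw [padicPi_apply_eq, map_zero, ZMod.val_zero, Nat.cast_zero, zero_smul, Pi.zero_apply]

variable {V p H'}

/-- **Additivity of `padicPi` in the scalar** on a family killed level-wise by `p^k`:
`(c + c') · y = c · y + c' · y`. [cite: PerrinRiou1987BSMF, §0 p. 401] -/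
theorem padicPi_add_left_of_levelTorsion {y : V.torsionH1Pi p H'} (hy : ∀ k, ((p : ℤ) ^ k) • y k = 0)
    (c c' : ℤ_[p]) : V.padicPi p H' (c + c') y = V.padicPi p H' c y + V.padicPi p H' c' y := by
  ext k
  rw [Pi.add_apply, padicPi_apply_eq, padicPi_apply_eq, padicPi_apply_eq, ← add_zsmul]
  refine zsmul_eq_zsmul_of_intCast_eq p (hy k) ?_
  push_cast
  rw [ZMod.natCast_zmod_val, ZMod.natCast_zmod_val, ZMod.natCast_zmod_val, map_add]

/-- `padicPi (−c) y = −padicPi c y` on such a family. [cite: PerrinRiou1987BSMF, §0 p. 401] -/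
theorem padicPi_neg_left_of_levelTorsion {y : V.torsionH1Pi p H'} (hy : ∀ k, ((p : ℤ) ^ k) • y k = 0)
    (c : ℤ_[p]) : V.padicPi p H' (-c) y = -V.padicPi p H' c y := by
  rw [eq_neg_iff_add_eq_zero, ← padicPi_add_left_of_levelTorsion hy, neg_add_cancel, padicPi_zero_left]

/-- `padicPi (k c) y = k • padicPi c y` for an INTEGER `k`, on such a family. [cite: PerrinRiou1987BSMF, §0 p. 401] -/
theorem padicPi_intCast_mul_left_of_levelTorsion {y : V.torsionH1Pi p H'}
    (hy : ∀ k, ((p : ℤ) ^ k) • y k = 0) (m : ℤ) (c : ℤ_[p]) :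
    V.padicPi p H' ((m : ℤ_[p]) * c) y = m • V.padicPi p H' c y := by
  ext k
  rw [Pi.smul_apply, padicPi_apply_eq, padicPi_apply_eq, smul_smul]
  refine zsmul_eq_zsmul_of_intCast_eq p (hy k) ?_
  push_cast
  rw [ZMod.natCast_zmod_val, ZMod.natCast_zmod_val, map_mul, map_intCast]

/-- **Kummer families are killed level-wise by `p^k`**: `p^k • κ(P)_k = κ(p^k P)_k = 0` (the level-`k`
kernel of the compact Kummer map is `p^k E(L')`). [cite: SilvermanAEC2009, VIII.§2 (the Kummer sequence)] -/
theorem levelTorsion_kummerFamily [V.IsElliptic] (P : V.fixedGeomPoints H') (k : ℕ) :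
    ((p : ℤ) ^ k) • V.kummerFamily p H' P k = 0 := by
  rw [← kummerFamilyHom_apply, ← Pi.smul_apply, ← map_zsmul, kummerFamilyHom_apply,
    kummerFamily_apply_eq_zero_iff]
  exact ⟨P, rfl⟩

end PadicPi

/-! ## §2 The local Kummer compact group is torsion-free; the chart detects relations -/

variable {K : Type u} [Field K] (W : WeierstrassCurve K) {E : Type u} [Field E] [Algebra K E]
  (ι : AlgebraicClosure K →ₐ[K] AlgebraicClosure E) (p : ℕ) [Fact p.Prime]

/-- **`E(L·E) ⊗ ℤ_p` IS TORSION-FREE and THE CHART DETECTS `ℤ_p`-RELATIONS** (hypotheses of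
`relIndex_localKummer_eq_index_span_chart`): (1) the local Kummer compact group `localKummerCompactOfEmb ι p ⊤`
meets the torsion subgroup of `∏_k H¹(H_E, E[p^k])` in `0`; (2) for `E`-rational points `R₁`, `R₂` and
`c₁, c₂ ∈ ℤ_p`, `c₁ · κ(R₁) + c₂ · κ(R₂) = 0` implies `c₁ Φ(R₁) + c₂ Φ(R₂) = 0`. Both through the
injective `ℤ_p`-linear factorisation `ψ` of the compact Kummer map through the chart (core file).
[cite: PerrinRiou1987BSMF, §0 p. 401] [cite: SilvermanAEC2009, VIII.§2 and Prop. VII.6.3] -/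
theorem localKummer_torsionFree_and_chart_detects [W.IsElliptic] [PerfectField K] [PerfectField E]
    {V : Type*} [AddCommGroup V] [Module ℤ_[p] V] [NoZeroSMulDivisors ℤ_[p] V]
    (Φ : (W.baseChange E).toAffine.Point →+ V) (hΦ : ∀ x, Φ x = 0 ↔ IsOfFinAddOrder x)
    (hΦs : Function.Surjective Φ)
    (hsep : ∀ v : V, (∀ k : ℕ, ∃ w : V, ((p : ℤ_[p]) ^ k) • w = v) → v = 0)
    (hE : ∀ x : (W.baseChange E).toAffine.Point, p • x = 0 → x = 0) :
    AddCommGroup.torsion ((W.baseChange E).torsionH1Pi p (localSubgroupOfEmb ⊤ ι)) ⊓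
        W.localKummerCompactOfEmb ι p ⊤ = ⊥ ∧
      ∀ (R₁ R₂ : (W.baseChange E).toAffine.Point) (c₁ c₂ : ℤ_[p]),
        (W.baseChange E).padicPi p (localSubgroupOfEmb ⊤ ι) c₁
            ((W.baseChange E).kummerFamily p (localSubgroupOfEmb ⊤ ι)
              ⟨toGeomPoints (W.baseChange E) R₁,
                toGeomPoints_mem_fixedGeomPoints W (localSubgroupOfEmb ⊤ ι) R₁⟩) +
          (W.baseChange E).padicPi p (localSubgroupOfEmb ⊤ ι) c₂
            ((W.baseChange E).kummerFamily p (localSubgroupOfEmb ⊤ ι)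
              ⟨toGeomPoints (W.baseChange E) R₂,
                toGeomPoints_mem_fixedGeomPoints W (localSubgroupOfEmb ⊤ ι) R₂⟩) = 0 →
        c₁ • Φ R₁ + c₂ • Φ R₂ = 0 := by
  -- the descent isomorphism `E_E(E) ≃ fixed points` (as in the index file)
  set j : (W.baseChange E).toAffine.Point →+ (W.baseChange E).fixedGeomPoints (localSubgroupOfEmb ⊤ ι) :=
    (toGeomPoints (W.baseChange E)).codRestrict _
      (toGeomPoints_mem_fixedGeomPoints W (localSubgroupOfEmb ⊤ ι)) with hj
  have hjval : ∀ R, ((j R : (W.baseChange E).fixedGeomPoints (localSubgroupOfEmb ⊤ ι)) :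
      geomPoints (W.baseChange E)) = toGeomPoints (W.baseChange E) R := fun _ ↦ rfl
  have hjbij : Function.Bijective j := by
    refine ⟨fun R R' h ↦ toGeomPoints_injective (W.baseChange E) (by rw [← hjval, ← hjval, h]),
      fun P ↦ ?_⟩
    obtain ⟨R, hR⟩ := exists_toGeomPoints_eq_of_mem_fixedGeomPoints_top W ι P.2
    exact ⟨R, Subtype.ext (by rw [hjval, hR])⟩
  set e : (W.baseChange E).toAffine.Point ≃+ (W.baseChange E).fixedGeomPoints (localSubgroupOfEmb ⊤ ι) :=
    AddEquiv.ofBijective j hjbij with he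
  have heR : ∀ R, e R = ⟨toGeomPoints (W.baseChange E) R,
      toGeomPoints_mem_fixedGeomPoints W (localSubgroupOfEmb ⊤ ι) R⟩ := fun _ ↦ rfl
  set Ψ : (W.baseChange E).fixedGeomPoints (localSubgroupOfEmb ⊤ ι) →+ V :=
    Φ.comp e.symm.toAddMonoidHom with hΨ
  have hΨe : ∀ R, Ψ (e R) = Φ R := fun R ↦ by
    rw [hΨ, AddMonoidHom.coe_comp, Function.comp_apply, AddEquiv.coe_toAddMonoidHom,
      AddEquiv.symm_apply_apply]
  have hΨ0 : ∀ P, Ψ P = 0 ↔ IsOfFinAddOrder P := fun P ↦ by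
    obtain ⟨R, rfl⟩ := e.surjective P
    rw [hΨe, hΦ]
    exact (Function.Injective.isOfFinAddOrder_iff (f := e.toAddMonoidHom) e.injective).symm
  have hG : ∀ v : V, v ∈ (⊤ : Submodule ℤ_[p] V) ↔
      ∃ P : (W.baseChange E).fixedGeomPoints (localSubgroupOfEmb ⊤ ι), Ψ P = v := fun v ↦
    ⟨fun _ ↦ by obtain ⟨R, hR⟩ := hΦs v; exact ⟨e R, by rw [hΨe, hR]⟩, fun _ ↦ Submodule.mem_top⟩
  have hmemG : ∀ P : (W.baseChange E).fixedGeomPoints (localSubgroupOfEmb ⊤ ι),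
      Ψ P ∈ (⊤ : Submodule ℤ_[p] V) := fun _ ↦ Submodule.mem_top
  have hM : ∀ P : (W.baseChange E).fixedGeomPoints (localSubgroupOfEmb ⊤ ι), p • P = 0 → P = 0 := by
    intro P hP
    obtain ⟨R, rfl⟩ := e.surjective P
    rw [← map_nsmul, e.map_eq_zero_iff] at hP
    rw [hE R hP, map_zero]
  have hκ : ∀ (P : (W.baseChange E).fixedGeomPoints (localSubgroupOfEmb ⊤ ι)) (k : ℕ),
      (W.baseChange E).kummerFamilyHom p (localSubgroupOfEmb ⊤ ι) P k = 0 ↔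
        ∃ R : (W.baseChange E).fixedGeomPoints (localSubgroupOfEmb ⊤ ι), ((p : ℤ) ^ k) • R = P :=
    fun P k ↦ by
      rw [kummerFamilyHom_apply]
      exact (W.baseChange E).kummerFamily_apply_eq_zero_iff p (localSubgroupOfEmb ⊤ ι) P k
  have hact := fun c x k ↦ padicPi_apply_eq p (W.baseChange E) (localSubgroupOfEmb ⊤ ι) c x k
  -- the factorisation `ψ`, `ℤ_p`-linear and injective
  obtain ⟨ψ, hψ⟩ := exists_factor_hom ((W.baseChange E).kummerFamilyHom p (localSubgroupOfEmb ⊤ ι))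
    Ψ ⊤ hM hκ hΨ0 hG
  have hsurj : ∀ g : (⊤ : Submodule ℤ_[p] V),
      ∃ P : (W.baseChange E).fixedGeomPoints (localSubgroupOfEmb ⊤ ι),
        (⟨Ψ P, hmemG P⟩ : (⊤ : Submodule ℤ_[p] V)) = g := fun g ↦ by
    obtain ⟨P, hP⟩ := (hG (g : V)).1 g.2
    exact ⟨P, Subtype.ext hP⟩
  have hlin : ∀ (g : (⊤ : Submodule ℤ_[p] V)) (c : ℤ_[p]),
      ψ (c • g) = (W.baseChange E).padicPi p (localSubgroupOfEmb ⊤ ι) c (ψ g) := by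
    intro g c
    obtain ⟨P, rfl⟩ := hsurj g
    obtain ⟨P', hP'⟩ := (hG (c • Ψ P)).1 Submodule.mem_top
    have hcg : c • (⟨Ψ P, hmemG P⟩ : (⊤ : Submodule ℤ_[p] V)) = ⟨Ψ P', hmemG P'⟩ :=
      Subtype.ext (by show c • Ψ P = Ψ P'; exact hP'.symm)
    rw [hcg, hψ, hψ]
    exact kummer_eq_act_of_chart_eq_smul _ _ Ψ ⊤ hM hκ hact hΨ0 hG hP'
  have hinj : Function.Injective ψ := by
    refine (injective_iff_map_eq_zero ψ).2 fun g hg ↦ ?_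
    obtain ⟨P, rfl⟩ := hsurj g
    rw [hψ] at hg
    exact Subtype.ext (chart_eq_zero_of_kummer_eq_zero _ Ψ hκ hsep hg)
  have hone : ∀ P : (W.baseChange E).fixedGeomPoints (localSubgroupOfEmb ⊤ ι),
      (W.baseChange E).kummerFamilyHom p (localSubgroupOfEmb ⊤ ι) P =
        (W.baseChange E).padicPi p (localSubgroupOfEmb ⊤ ι) 1
          ((W.baseChange E).kummerFamilyHom p (localSubgroupOfEmb ⊤ ι) P) := fun P ↦
    kummer_eq_act_of_chart_eq_smul _ _ Ψ ⊤ hM hκ hact hΨ0 hG (P := P) (P' := P) (c := 1)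
      (by rw [one_smul])
  -- `B = ψ(⊤)`
  have hB : W.localKummerCompactOfEmb ι p ⊤ = (⊤ : AddSubgroup (⊤ : Submodule ℤ_[p] V)).map ψ := by
    rw [localKummerCompactOfEmb_eq_closure]
    apply le_antisymm
    · rw [AddSubgroup.closure_le]
      rintro x ⟨P, c, rfl⟩
      refine AddSubgroup.mem_map.2 ⟨c • ⟨Ψ P, hmemG P⟩, AddSubgroup.mem_top _, ?_⟩
      rw [hlin, hψ]
    · intro x hx
      obtain ⟨g, -, rfl⟩ := AddSubgroup.mem_map.1 hx
      obtain ⟨P, rfl⟩ := hsurj g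
      rw [hψ, hone P]
      exact AddSubgroup.subset_closure ⟨P, 1, rfl⟩
  refine ⟨?_, fun R₁ R₂ c₁ c₂ h ↦ ?_⟩
  · -- torsion-free
    rw [eq_bot_iff]
    intro x hx'
    obtain ⟨hx, hxB⟩ := AddSubgroup.mem_inf.1 hx'
    rw [hB] at hxB
    obtain ⟨g, -, rfl⟩ := AddSubgroup.mem_map.1 hxB
    rw [AddCommGroup.mem_torsion, isOfFinAddOrder_iff_nsmul_eq_zero] at hx
    obtain ⟨n, hn, hng⟩ := hx
    rw [← map_nsmul, ← (map_zero ψ)] at hng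
    have hng' : n • g = 0 := hinj hng
    have hg0 : g = 0 := by
      have h2 : ((n : ℤ_[p]) • g) = 0 := by rw [Nat.cast_smul_eq_nsmul]; exact hng'
      rcases smul_eq_zero.mp h2 with h | h
      · exact absurd h (Nat.cast_ne_zero.mpr hn.ne')
      · exact h
    rw [AddSubgroup.mem_bot, hg0, map_zero]
  · -- detection of relations
    have h1 : ∀ (R : (W.baseChange E).toAffine.Point) (c : ℤ_[p]),
        (W.baseChange E).padicPi p (localSubgroupOfEmb ⊤ ι) c
          ((W.baseChange E).kummerFamily p (localSubgroupOfEmb ⊤ ι)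
            ⟨toGeomPoints (W.baseChange E) R,
              toGeomPoints_mem_fixedGeomPoints W (localSubgroupOfEmb ⊤ ι) R⟩) =
        ψ (c • ⟨Φ R, Submodule.mem_top⟩) := fun R c ↦ by
      have hg : (⟨Φ R, Submodule.mem_top⟩ : (⊤ : Submodule ℤ_[p] V)) = ⟨Ψ (e R), hmemG (e R)⟩ :=
        Subtype.ext (hΨe R).symm
      rw [hg, hlin, hψ, ← heR, kummerFamilyHom_apply]
    rw [h1, h1, ← map_add, ← (map_zero ψ)] at h
    have h0 := hinj h
    exact congrArg Subtype.val h0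

end Summit.BirchSwinnertonDyer.BirchSwinnertonDyer.Theorems.RamifiedSevenEllipticUnits.KummerCore

end
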